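import Summits.HodgeConjecture.HodgeConjecture.Cruxes.BlochSeedDiscOne.HeightTower

/-!
line stmt-HodgeConjecture-18881 Cruxes/BlochSeedDiscOne/Lines/birth.lean 814a6a70c14e831a stub_rung_pad4_seedAt

# RotatedPairB136 — a 136-COPY (A1)-clean (A4) integer design with `μ ≠ 0`, rank `8`, on the height-9 alphabet:
`Nonex 14 199 8`, `DepthBound 14 199 8 3` (the statement of `stub_depthBound_three`, the node's «conjecture of record»), colour-1's `DB 3`,
`FloorFree 9 199 8`, `KTops 95`, `SparseNonex 14 199 199 8`, `ScaledNonex 14 199 8` are ALL FALSE — KERNEL CERTIFICATE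
(planner `plan-lens-HodgeAV-strengthen` g14, 2026-08-30; same method and boiler-plate as `RotatedPairA4Design.lean`).

STATUS ∕ SCOPE.  Letter-model statements about `DepthBoundA4.Design` only (Chern-character words on a letter model ≠ sheaves ≠ the kernel of a SEED):
nothing here is a monad, a source, a SEED or a design of record, and NOTHING here is proved toward HC ∕ HC_CM ∕ HC_AV ∕ №4 ∕ 26512 ∕ 18881 ∕ H2.
What this file decides is the TYPED letter-model target of the `DepthBoundA4` line: its registered stub `stub_depthBound_three : DepthBound 14 199 8 3`
is FALSE as typed (`not_depthBound_three`), and so is every statement of the tree that implies `Nonex 14 199 8`.  It does NOT decide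
`FloorFree h 199 8` for `h ∈ {6, 7, 8, 10}` nor `Nonex h 199 8` for `h ≤ 8` (in particular not the live node target `FloorFree 6 199 8`).

THE DESIGN (§3).  `N = 8·hub⁴ + Σ_{k<4} 16·(ρᵏt)⁴`, `P = Σ_{k<4} (ρᵏu′)^{⊠4}` with `hub = (9;0,0)`, `t = (2;−4,3)` (so `u = 2·t`),
`u′ = (0;4,5) + (4;4,1)`, `ρ` = rotation `β ↦ iβ`: 5 N-cells (multiplicities 8,16,16,16,16) and 64 P-cells (multiplicity 1);
copies `72 + 64 = 136 ≤ 199`, rank `72 − 64 = 8`.  WHY (A1): `u, u′` have equal moment vectors `(U₁, U_h, U_pt) = (2, 4, −42)` and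
`|Σβ| = |Σβ′| = 10` (`−8+6i` vs `8+6i`); the `C₄`-orbit sums kill every mixed word with `#e ≢ #ē (mod 4)`, the `(e,ē)`-balanced and the e-free
words cancel between `N` and `P` (e-free charges `q_d = 8·9^d` from the hub alone), and `μ = 4·(conj(E)⁴ − conj(E′)⁴) = 43008·i ≠ 0`.
WHY (A4): every P-letter is off-axis with `a ≤ 4`, hence amply below the hub; `t = (2;−4,3)` is amply above `ρ(0;4,5) = (0;−5,4)`
(`1 + 1 < 2²`), so the N-cell `(ρᵏt)⁴` is live above the P-cell `(ρᵏ⁺¹(0;4,5))⁴`.  (A4♯) (colour-1: every weakly-live arrow is live) also holds (§4, `a4sharp_D`).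

KERNEL-CHECKED HERE (`decide +kernel` on the closed form of `T(D)` exactly as in `RotatedPairA4Design.lean` §2, and on the flat cell lists):
* `design_cert : D.OnAlphabet 9 ∧ D.A1 ∧ D.A4 ∧ D.mu ≠ 0 ∧ D.copies = 136 ∧ D.rank = 8`, `mu_eq : D.mu = ⟨0, 43008⟩`, `a4sharp_D : D.A4sharp`;
* `not_nonex_nine : ¬ Nonex 9 136 8`; `not_nonex : ∀ h ≥ 9, ∀ B ≥ 136, ¬ Nonex h B 8` (shift up, `HeightTower.nonex_of_nonex_up`);
  `not_nonex_fourteen : ¬ Nonex 14 199 8`; `exists_design : ∀ h ≥ 9, ∃ E, E.OnAlphabet h ∧ E.A1 ∧ E.A4 ∧ E.mu ≠ 0 ∧ E.copies = 136 ∧ E.rank = 8`;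
* `not_floorFree_nine : ∀ B ≥ 136, ¬ FloorFree 9 B 8` (the P-cell `(0;4,5)⁴` is a floor cell); `not_nine_floors : ¬ (∀ h, 6 ≤ h → h ≤ 14 → FloorFree h 199 8)`;
* `not_depthBound_three : ¬ DepthBound 14 199 8 3` (via `a4_closed_of_depthBound_three`), and directly `not_depthBound : ∀ c₀ ≤ 8, ¬ DepthBound 14 199 8 c₀`
  (the shifted design `shiftD 5 D` on the height-14 alphabet has the P-letter `(5;4,5)` of co-level 9);
* `not_DB : ∀ c₀ ≤ 8, ¬ DB c₀`, `not_DB_three : ¬ DB 3` (colour-1's six-hypothesis form with (A4♯) and (CONN); transport `a4sharp_shift` proved here);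
* `not_kTops : ¬ KTops 95`, `not_sparseNonex : ¬ SparseNonex 14 199 199 8`, `not_scaledNonex : ¬ ScaledNonex 14 199 8` (each implies `Nonex 14 199 8` in `IntegralityGap`).
CONSEQUENCES FOR THE NODE (pen, one line each): the height tower above floor 8 is dead at the budget of record (`Nonex h 199 8` false for every `h ≥ 9`);
the «nine floors» conjunction is false (floor 9; the same family gives 136-copy floor designs at h = 11, 12, 13, 14 — stdlib-verified, see the memo — and none
with `U₁ = 2` at h = 6, 7, 8, 10); `B*(h) ≤ 136` for `h ≥ 9`; what survives as typed targets are `Nonex h 199 8` for `h ≤ 8` and the single floors 6, 7, 8, 10.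
FAMILY FACTS (pen + stdlib enumeration, eng/rotpair_h.py): a rotated pair `(u, u′)` with `U₁ = 2` has copies `8 + 2·4·2⁴ = 136`; such pairs with (A1) ∧ (A4) ∧ μ ≠ 0
exist at h = 9 (8 pairs), 10 (8), 11 (24), 12 (40), 13 (72), 14 (96) and at no h ≤ 8.
PROVENANCE (irrelevant to validity): eng/rotpair_h.py (h-parametrised rotpair2.py), explicit_cert_h.py → memo-21/b136/NONEX-h9-B136.json (stdlib verifier
verify_explicit.py: ALL CHECKS PASS), eng/gen_b136.py → this file.  `decide +kernel` only: no `native_decide`, no `sorry`, no `axiom`, no `instance`, no notation,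
no Literature fact, no unsafe options.  The two `sorry` stubs of `DepthBoundA4.lean` are NOT used (this file proves the NEGATION of the second one's statement).
-/

set_option linter.dupNamespace false
set_option autoImplicit false
set_option maxRecDepth 8192
set_option maxHeartbeats 4000000

namespace Summit.HodgeConjecture.HodgeConjecture.Cruxes.BlochSeedDiscOne.RotatedPairB136

open Summit.HodgeConjecture.HodgeConjecture.Cruxes.BlochSeedDiscOne.DepthBoundA4
open Summit.HodgeConjecture.HodgeConjecture.Cruxes.BlochSeedDiscOne.IntegralityGap
open Summit.HodgeConjecture.HodgeConjecture.Cruxes.BlochSeedDiscOne.HeightTower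

/-! ## §1 Raw `ℤ[i]` arithmetic and the raw class-tensor evaluator (the `DesignKernel.lean` idiom, for `DepthBoundA4.Design`) -/

/-- product of Gaussian integers written as integer pairs `(re, im)`. -/
def gmul (a b : ℤ × ℤ) : ℤ × ℤ := (a.1 * b.1 - a.2 * b.2, a.1 * b.2 + a.2 * b.1)

/-- the pair as a Gaussian integer. -/
def toG (p : ℤ × ℤ) : GaussianInt := ⟨p.1, p.2⟩

theorem toG_gmul (a b : ℤ × ℤ) : toG (gmul a b) = toG a * toG b := by
  ext
  · simp [toG, gmul, Zsqrtd.re_mul]; ring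
  · simp [toG, gmul, Zsqrtd.im_mul]

/-- force an integer to constructor form before continuing (keeps kernel evaluation of long folds strict). -/
def forceInt {α : Type} (z : ℤ) (k : ℤ → α) : α :=
  match z with
  | Int.ofNat n => k (Int.ofNat n)
  | Int.negSucc n => k (Int.negSucc n)

theorem forceInt_eq {α : Type} (z : ℤ) (k : ℤ → α) : forceInt z k = k z := by
  cases z <;> rfl

/-- raw coefficient of a symbol at a letter: `1 ↦ 1`, `h ↦ a`, `e ↦ β̄`, `ē ↦ β`, `pt ↦ a² − |β|²`. -/
def symv (ℓ : Letter) : Sym → ℤ × ℤ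
  | .one => (1, 0)
  | .h => (ℓ.a, 0)
  | .e => (ℓ.x, -ℓ.y)
  | .ebar => (ℓ.x, ℓ.y)
  | .pt => (ℓ.a * ℓ.a - ℓ.x * ℓ.x - ℓ.y * ℓ.y, 0)

theorem toG_symv (ℓ : Letter) (s : Sym) : toG (symv ℓ s) = s.coef ℓ := by
  cases s <;> (ext <;> (simp [toG, symv, Sym.coef, Letter.beta, Letter.selfInt, Letter.bnorm, pow_two]; try ring))

/-- raw class tensor of one cell at a word. -/
def chRaw (c : Cell) (w : Word) : ℤ × ℤ :=
  gmul (gmul (gmul (symv (c 0) (w 0)) (symv (c 1) (w 1))) (symv (c 2) (w 2))) (symv (c 3) (w 3))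

theorem toG_chRaw (c : Cell) (w : Word) : toG (chRaw c w) = cellCoef c w := by
  simp only [chRaw, toG_gmul, toG_symv, cellCoef, Fin.prod_univ_four]

/-- the list sum `Σ m · cellCoef` (the summand of `Design.T`). -/
def listSum (w : Word) (L : List (Cell × ℕ)) : GaussianInt := (L.map fun cm => (cm.2 : GaussianInt) * cellCoef cm.1 w).sum

theorem listSum_nil (w : Word) : listSum w [] = 0 := by simp [listSum]

theorem listSum_cons (w : Word) (cm : Cell × ℕ) (L : List (Cell × ℕ)) :
    listSum w (cm :: L) = (cm.2 : GaussianInt) * cellCoef cm.1 w + listSum w L := by simp [listSum]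

theorem listSum_append (w : Word) (L M : List (Cell × ℕ)) : listSum w (L ++ M) = listSum w L + listSum w M := by
  simp [listSum, List.map_append, List.sum_append]

theorem T_eq_listSum (E : Design) (w : Word) : E.T w = listSum w E.N - listSum w E.P := rfl

/-- componentwise pair operations (raw `ℤ[i]` addition, subtraction, integer scaling). -/
def padd (a b : ℤ × ℤ) : ℤ × ℤ := (a.1 + b.1, a.2 + b.2)
/-- subtraction. -/
def psub (a b : ℤ × ℤ) : ℤ × ℤ := (a.1 - b.1, a.2 - b.2)
/-- scaling. -/
def pscale (k : ℤ) (a : ℤ × ℤ) : ℤ × ℤ := (k * a.1, k * a.2)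

theorem toG_padd (a b : ℤ × ℤ) : toG (padd a b) = toG a + toG b := by ext <;> simp [toG, padd]
theorem toG_psub (a b : ℤ × ℤ) : toG (psub a b) = toG a - toG b := by ext <;> simp [toG, psub]
theorem toG_pscale (k : ℤ) (a : ℤ × ℤ) : toG (pscale k a) = (k : GaussianInt) * toG a := by
  ext <;> simp [toG, pscale]

/-! ## §2 Boolean list checkers, words, cells -/

/-- every element passes (tail form). -/
def allB {α : Type} : List α → (α → Bool) → Bool
  | [], _ => true
  | x :: l, f => match f x with | true => allB l f | false => false

theorem allB_iff {α : Type} (l : List α) (f : α → Bool) : allB l f = true ↔ ∀ x ∈ l, f x = true := by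
  induction l with
  | nil => simp [allB]
  | cons x l ih =>
    simp only [allB, List.mem_cons, forall_eq_or_imp]
    cases hx : f x <;> simp [ih]

/-- some element passes (tail form). -/
def anyB {α : Type} : List α → (α → Bool) → Bool
  | [], _ => false
  | x :: l, f => match f x with | true => true | false => anyB l f

theorem anyB_iff {α : Type} (l : List α) (f : α → Bool) : anyB l f = true ↔ ∃ x ∈ l, f x = true := by
  induction l with
  | nil => simp [anyB]
  | cons x l ih =>
    simp only [anyB, List.mem_cons, exists_eq_or_imp]
    cases hx : f x <;> simp [ih]

/-- a word from four symbols. -/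
def wordOf (s₀ s₁ s₂ s₃ : Sym) : Word := fun f =>
  match f with
  | ⟨0, _⟩ => s₀
  | ⟨1, _⟩ => s₁
  | ⟨2, _⟩ => s₂
  | ⟨_, _⟩ => s₃

theorem wordOf_eta (w : Word) : wordOf (w 0) (w 1) (w 2) (w 3) = w := by
  funext f
  fin_cases f <;> rfl

/-- a cell from four letters. -/
def cellOf (l₀ l₁ l₂ l₃ : Letter) : Cell := fun f =>
  match f with
  | ⟨0, _⟩ => l₀
  | ⟨1, _⟩ => l₁
  | ⟨2, _⟩ => l₂
  | ⟨_, _⟩ => l₃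

theorem cellCoef_cellOf (a b c d : Letter) (w : Word) :
    cellCoef (cellOf a b c d) w = (w 0).coef a * (w 1).coef b * (w 2).coef c * (w 3).coef d := by
  simp only [cellCoef, Fin.prod_univ_four]
  rfl

/-! ### Product blocks `u^{⊠4}` and the slot-by-slot factorisation of their class tensor -/

/-- weighted letter sum `Σ m·φ(ℓ)` over a letter list `u`. -/
def lsum (u : List (Letter × ℕ)) (φ : Letter → GaussianInt) : GaussianInt := (u.map fun e => (e.2 : GaussianInt) * φ e.1).sum

theorem lsum_nil (φ : Letter → GaussianInt) : lsum [] φ = 0 := by simp [lsum]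

theorem lsum_cons (e : Letter × ℕ) (u : List (Letter × ℕ)) (φ : Letter → GaussianInt) :
    lsum (e :: u) φ = (e.2 : GaussianInt) * φ e.1 + lsum u φ := by simp [lsum]

/-- level 3: the last slot runs over `u`. -/
def blk3 (u : List (Letter × ℕ)) (a b c : Letter) (m : ℕ) : List (Cell × ℕ) := u.map fun e => (cellOf a b c e.1, m * e.2)
/-- level 2. -/
def blk2 (u : List (Letter × ℕ)) (a b : Letter) (m : ℕ) : List (Cell × ℕ) := u.flatMap fun e => blk3 u a b e.1 (m * e.2)
/-- level 1. -/
def blk1 (u : List (Letter × ℕ)) (a : Letter) (m : ℕ) : List (Cell × ℕ) := u.flatMap fun e => blk2 u a e.1 (m * e.2)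
/-- the product block `u^{⊠4}`: every cell with letters from `u`, multiplicity the product of the four weights. -/
def prod4 (u : List (Letter × ℕ)) : List (Cell × ℕ) := u.flatMap fun e => blk1 u e.1 e.2

theorem listSum_blk3 (w : Word) (u : List (Letter × ℕ)) (a b c : Letter) (m : ℕ) :
    listSum w (blk3 u a b c m) = (m : GaussianInt) * ((w 0).coef a * (w 1).coef b * (w 2).coef c) * lsum u (w 3).coef := by
  induction u with
  | nil => simp [blk3, listSum, lsum]
  | cons e u ih =>
    have h3 : blk3 (e :: u) a b c m = (cellOf a b c e.1, m * e.2) :: blk3 u a b c m := rfl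
    rw [h3, listSum_cons, ih, lsum_cons, cellCoef_cellOf]
    push_cast
    ring

theorem listSum_blk2 (w : Word) (v u : List (Letter × ℕ)) (a b : Letter) (m : ℕ) :
    listSum w (v.flatMap fun e => blk3 u a b e.1 (m * e.2)) =
      (m : GaussianInt) * ((w 0).coef a * (w 1).coef b) * lsum v (w 2).coef * lsum u (w 3).coef := by
  induction v with
  | nil => simp [listSum, lsum]
  | cons e v ih =>
    rw [List.flatMap_cons, listSum_append, ih, listSum_blk3, lsum_cons]
    push_cast
    ring

theorem listSum_blk1 (w : Word) (v u : List (Letter × ℕ)) (a : Letter) (m : ℕ) :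
    listSum w (v.flatMap fun e => blk2 u a e.1 (m * e.2)) =
      (m : GaussianInt) * (w 0).coef a * lsum v (w 1).coef * lsum u (w 2).coef * lsum u (w 3).coef := by
  induction v with
  | nil => simp [listSum, lsum]
  | cons e v ih =>
    rw [List.flatMap_cons, listSum_append, ih, lsum_cons]
    have h2 : blk2 u a e.1 (m * e.2) = u.flatMap fun e' => blk3 u a e.1 e'.1 ((m * e.2) * e'.2) := rfl
    rw [h2, listSum_blk2]
    push_cast
    ring

theorem listSum_prod4_aux (w : Word) (v u : List (Letter × ℕ)) :
    listSum w (v.flatMap fun e => blk1 u e.1 e.2) = lsum v (w 0).coef * lsum u (w 1).coef * lsum u (w 2).coef * lsum u (w 3).coef := by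
  induction v with
  | nil => simp [listSum, lsum]
  | cons e v ih =>
    rw [List.flatMap_cons, listSum_append, ih, lsum_cons]
    have h1 : blk1 u e.1 e.2 = u.flatMap fun e' => blk2 u e.1 e'.1 (e.2 * e'.2) := rfl
    rw [h1, listSum_blk1]
    ring

/-- THE FACTORISATION: `T(u^{⊠4})(w) = Π_f ⟨u, w_f⟩`. -/
theorem listSum_prod4 (w : Word) (u : List (Letter × ℕ)) :
    listSum w (prod4 u) = lsum u (w 0).coef * lsum u (w 1).coef * lsum u (w 2).coef * lsum u (w 3).coef :=
  listSum_prod4_aux w u u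

/-- raw letter sum `Σ m·symv(ℓ)(s)`, accumulator form. -/
def lsumRaw (s : Sym) : List (Letter × ℕ) → ℤ → ℤ → ℤ × ℤ
  | [], p, q => (p, q)
  | (ℓ, m) :: u, p, q =>
    match symv ℓ s with
    | (a, b) => forceInt (p + (m : ℤ) * a) fun p' => forceInt (q + (m : ℤ) * b) fun q' => lsumRaw s u p' q'

theorem toG_lsumRaw (s : Sym) (u : List (Letter × ℕ)) (p q : ℤ) : toG (lsumRaw s u p q) = toG (p, q) + lsum u s.coef := by
  induction u generalizing p q with
  | nil => simp [lsumRaw, lsum, toG]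
  | cons e u ih =>
    obtain ⟨ℓ, m⟩ := e
    have hc : toG (symv ℓ s) = s.coef ℓ := toG_symv ℓ s
    simp only [lsumRaw, forceInt_eq]
    rw [ih, lsum_cons, ← hc]
    ext
    · simp [toG]; ring
    · simp [toG]; ring

/-- raw class tensor of a product block: the product of the four raw letter sums. -/
def blockRaw (u : List (Letter × ℕ)) (w : Word) : ℤ × ℤ :=
  gmul (gmul (gmul (lsumRaw (w 0) u 0 0) (lsumRaw (w 1) u 0 0)) (lsumRaw (w 2) u 0 0)) (lsumRaw (w 3) u 0 0)

theorem toG_zero : toG ((0 : ℤ), (0 : ℤ)) = 0 := by ext <;> simp [toG]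

theorem toG_blockRaw (u : List (Letter × ℕ)) (w : Word) : toG (blockRaw u w) = listSum w (prod4 u) := by
  rw [listSum_prod4]
  simp only [blockRaw, toG_gmul, toG_lsumRaw, toG_zero, zero_add]

/-- the five symbols. -/
def syms : List Sym := [Sym.one, Sym.h, Sym.e, Sym.ebar, Sym.pt]

theorem mem_syms (s : Sym) : s ∈ syms := by
  cases s <;> simp [syms]

/-- all 625 words. -/
def allWords : List Word :=
  syms.flatMap fun a => syms.flatMap fun b => syms.flatMap fun c => syms.map fun d => wordOf a b c d

theorem mem_allWords (w : Word) : w ∈ allWords := by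
  rw [← wordOf_eta w]
  simp only [allWords, List.mem_flatMap, List.mem_map]
  exact ⟨w 0, mem_syms _, w 1, mem_syms _, w 2, mem_syms _, w 3, mem_syms _, rfl⟩

/-- e-free test (raw form of `Word.efree`). -/
def efreeB (w : Word) : Bool := (w 0).efree && (w 1).efree && (w 2).efree && (w 3).efree

theorem efree_of_efreeB {w : Word} (h : efreeB w = true) : w.efree := by
  simp only [efreeB, Bool.and_eq_true] at h
  obtain ⟨⟨⟨h0, h1⟩, h2⟩, h3⟩ := h
  intro f
  fin_cases f
  · exact h0
  · exact h1
  · exact h2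
  · exact h3

theorem efreeB_of_efree {w : Word} (h : w.efree) : efreeB w = true := by
  simp [efreeB, h 0, h 1, h 2, h 3]

/-- Bloch-word test (raw form of `w = eeee ∨ w = ēēēē`). -/
def blochB (w : Word) : Bool :=
  (decide (w 0 = Sym.e) && decide (w 1 = Sym.e) && decide (w 2 = Sym.e) && decide (w 3 = Sym.e)) ||
  (decide (w 0 = Sym.ebar) && decide (w 1 = Sym.ebar) && decide (w 2 = Sym.ebar) && decide (w 3 = Sym.ebar))

theorem bloch_of_blochB {w : Word} (h : blochB w = true) : w = Word.eeee ∨ w = Word.EEEE := by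
  simp only [blochB, Bool.or_eq_true, Bool.and_eq_true, decide_eq_true_eq] at h
  rcases h with ⟨⟨⟨h0, h1⟩, h2⟩, h3⟩ | ⟨⟨⟨h0, h1⟩, h2⟩, h3⟩
  · left; funext f; fin_cases f
    · exact h0
    · exact h1
    · exact h2
    · exact h3
  · right; funext f; fin_cases f
    · exact h0
    · exact h1
    · exact h2
    · exact h3

/-- raw degree. -/
def degB (w : Word) : ℕ := (w 0).deg + (w 1).deg + (w 2).deg + (w 3).deg

theorem deg_eq_degB (w : Word) : w.deg = degB w := by
  simp only [Word.deg, Fin.sum_univ_four, degB]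

/-- raw alphabet test for a letter and a cell (raw form of `Letter.OnAlphabet`). -/
def lettB (h : ℤ) (ℓ : Letter) : Bool := decide (ℓ.a + |ℓ.x| + |ℓ.y| = h ∧ 0 ≤ ℓ.a)

/-- cell on the alphabet. -/
def onAlphaB (h : ℤ) (c : Cell) : Bool := lettB h (c 0) && lettB h (c 1) && lettB h (c 2) && lettB h (c 3)

theorem onAlphabet_of_B {h : ℤ} {c : Cell} (hc : onAlphaB h c = true) : ∀ f : Fin 4, (c f).OnAlphabet h := by
  simp only [onAlphaB, lettB, Bool.and_eq_true, decide_eq_true_eq] at hc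
  obtain ⟨⟨⟨h0, h1⟩, h2⟩, h3⟩ := hc
  intro f
  fin_cases f
  · exact h0
  · exact h1
  · exact h2
  · exact h3

/-- raw ample-above test (squares written as products). -/
def ampleB (ℓ ℓ' : Letter) : Bool :=
  decide (ℓ.a < ℓ'.a) && decide ((ℓ'.x - ℓ.x) * (ℓ'.x - ℓ.x) + (ℓ'.y - ℓ.y) * (ℓ'.y - ℓ.y) < (ℓ'.a - ℓ.a) * (ℓ'.a - ℓ.a))

theorem ampleAbove_of_B {ℓ ℓ' : Letter} (h : ampleB ℓ ℓ' = true) : AmpleAbove ℓ ℓ' := by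
  simp only [ampleB, Bool.and_eq_true, decide_eq_true_eq] at h
  refine ⟨h.1, ?_⟩
  simp only [pow_two]
  exact h.2

/-- raw live test. -/
def liveB (x y : Cell) : Bool := ampleB (x 0) (y 0) && ampleB (x 1) (y 1) && ampleB (x 2) (y 2) && ampleB (x 3) (y 3)

theorem live_of_B {x y : Cell} (h : liveB x y = true) : Live x y := by
  simp only [liveB, Bool.and_eq_true] at h
  obtain ⟨⟨⟨h0, h1⟩, h2⟩, h3⟩ := h
  intro f
  fin_cases f
  · exact ampleAbove_of_B h0
  · exact ampleAbove_of_B h1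
  · exact ampleAbove_of_B h2
  · exact ampleAbove_of_B h3

/-- support membership from an entry with positive multiplicity. -/
theorem mem_suppN_of {D : Design} {c : Cell} {m : ℕ} (h : (c, m) ∈ D.N) (hm : 0 < m) : c ∈ D.suppN :=
  List.mem_map.2 ⟨(c, m), List.mem_filter.2 ⟨h, by simpa using hm⟩, rfl⟩

theorem mem_suppP_of {D : Design} {c : Cell} {m : ℕ} (h : (c, m) ∈ D.P) (hm : 0 < m) : c ∈ D.suppP :=
  List.mem_map.2 ⟨(c, m), List.mem_filter.2 ⟨h, by simpa using hm⟩, rfl⟩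

theorem exists_of_mem_suppN {D : Design} {c : Cell} (h : c ∈ D.suppN) : ∃ m, (c, m) ∈ D.N := by
  obtain ⟨cm, hcm, rfl⟩ := List.mem_map.1 h
  exact ⟨cm.2, (List.mem_filter.1 hcm).1⟩

theorem exists_of_mem_suppP {D : Design} {c : Cell} (h : c ∈ D.suppP) : ∃ m, (c, m) ∈ D.P := by
  obtain ⟨cm, hcm, rfl⟩ := List.mem_map.1 h
  exact ⟨cm.2, (List.mem_filter.1 hcm).1⟩

/-! ## §3 The design `D = (8·hub⁴ + Σ_k (ρᵏu)^{⊠4}, Σ_k (ρᵏu′)^{⊠4})` -/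

/-- the hub cell `(9;0,0)⁴`. -/
def hub4 : Cell := cellOf ⟨9, 0, 0⟩ ⟨9, 0, 0⟩ ⟨9, 0, 0⟩ ⟨9, 0, 0⟩

/-- the floor cell `(0;4,5)⁴`. -/
def floor4 : Cell := cellOf ⟨0, 4, 5⟩ ⟨0, 4, 5⟩ ⟨0, 4, 5⟩ ⟨0, 4, 5⟩

/-- `u = 2·(2;−4,3)` and its rotations `ρᵏu`, `ρ(a;x,y) = (a;−y,x)` (one letter of multiplicity 2: the block `u^{⊠4}` is the single cell `(2;−4,3)⁴` with multiplicity 16). -/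
def uN0 : List (Letter × ℕ) := [(⟨2, -4, 3⟩, 2)]
def uN1 : List (Letter × ℕ) := [(⟨2, -3, -4⟩, 2)]
def uN2 : List (Letter × ℕ) := [(⟨2, 4, -3⟩, 2)]
def uN3 : List (Letter × ℕ) := [(⟨2, 3, 4⟩, 2)]
/-- `u′ = (0;4,5) + (4;4,1)` and its rotations (the floor letter `(0;4,5)` first). -/
def vP0 : List (Letter × ℕ) := [(⟨0, 4, 5⟩, 1), (⟨4, 4, 1⟩, 1)]
def vP1 : List (Letter × ℕ) := [(⟨0, -5, 4⟩, 1), (⟨4, -1, 4⟩, 1)]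
def vP2 : List (Letter × ℕ) := [(⟨0, -4, -5⟩, 1), (⟨4, -4, -1⟩, 1)]
def vP3 : List (Letter × ℕ) := [(⟨0, 5, -4⟩, 1), (⟨4, 1, -4⟩, 1)]

/-- N-list: `8·hub⁴` first, then the four rotated product blocks (each a single cell `(ρᵏ(2;−4,3))⁴` of multiplicity `2⁴ = 16`). -/
def DN : List (Cell × ℕ) := (hub4, 8) :: (prod4 uN0 ++ prod4 uN1 ++ prod4 uN2 ++ prod4 uN3)

/-- P-list: the four rotated product blocks of `u′` (the first cell of the first block is the floor cell `(0;4,5)⁴`). -/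
def DP : List (Cell × ℕ) := prod4 vP0 ++ prod4 vP1 ++ prod4 vP2 ++ prod4 vP3

/-- the rotated-pair design. -/
def D : Design := ⟨DN, DP⟩

theorem hub4_mem : (hub4, 8) ∈ D.N := List.mem_cons_self

theorem floor4_mem : (floor4, 1) ∈ D.P :=
  List.mem_append_left _ (List.mem_append_left _ (List.mem_append_left _ List.mem_cons_self))

/-- raw closed form of `T(D)(w)`: `8·ch(hub⁴)(w) + Σ_k block(ρᵏu)(w) − Σ_k block(ρᵏu′)(w)`. -/
def rawClosed (w : Word) : ℤ × ℤ :=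
  psub (padd (pscale 8 (chRaw hub4 w))
          (padd (padd (padd (blockRaw uN0 w) (blockRaw uN1 w)) (blockRaw uN2 w)) (blockRaw uN3 w)))
       (padd (padd (padd (blockRaw vP0 w) (blockRaw vP1 w)) (blockRaw vP2 w)) (blockRaw vP3 w))

theorem T_split (w : Word) : D.T w = (8 : GaussianInt) * cellCoef hub4 w
    + (listSum w (prod4 uN0) + listSum w (prod4 uN1) + listSum w (prod4 uN2) + listSum w (prod4 uN3))
    - (listSum w (prod4 vP0) + listSum w (prod4 vP1) + listSum w (prod4 vP2) + listSum w (prod4 vP3)) := by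
  rw [T_eq_listSum]
  have hN : D.N = (hub4, 8) :: (prod4 uN0 ++ prod4 uN1 ++ prod4 uN2 ++ prod4 uN3) := rfl
  have hP : D.P = prod4 vP0 ++ prod4 vP1 ++ prod4 vP2 ++ prod4 vP3 := rfl
  rw [hN, hP, listSum_cons, listSum_append, listSum_append, listSum_append, listSum_append, listSum_append, listSum_append]
  push_cast
  ring

theorem T_closed (w : Word) : D.T w = toG (rawClosed w) := by
  rw [T_split]
  simp only [rawClosed, toG_psub, toG_padd, toG_pscale, toG_chRaw, toG_blockRaw]
  push_cast
  ring

/-! ## §4 The kernel computations (`decide +kernel`) -/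

/-- one row of the (A1) table on the closed form: e-free words evaluate to `8·9^deg` (real), every other word except the two Bloch words vanishes. -/
def a1Row (w : Word) : Bool :=
  bif efreeB w then decide (rawClosed w = ((8 : ℤ) * 9 ^ degB w, 0)) else (blochB w || decide (rawClosed w = (0, 0)))

theorem a1_table : allB allWords a1Row = true := by decide +kernel

theorem mu_raw : rawClosed Word.eeee = (0, 43008) := by decide +kernel

theorem copies_eq : D.copies = 136 := by decide +kernel

theorem rank_eq : D.rank = 8 := by decide +kernel

theorem posN : allB DN (fun cm => decide (0 < cm.2)) = true := by decide +kernel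

theorem posP : allB DP (fun cm => decide (0 < cm.2)) = true := by decide +kernel

theorem alphaN : allB DN (fun cm => onAlphaB 9 cm.1) = true := by decide +kernel

theorem alphaP : allB DP (fun cm => onAlphaB 9 cm.1) = true := by decide +kernel

/-- (A4).1 witnesses: every P-cell is live below `hub⁴`. -/
theorem a4P : allB DP (fun cm => liveB cm.1 hub4) = true := by decide +kernel

/-- (A4).2 witnesses: every N-cell has a live P-cell below it (brute force over the P-list). -/
theorem a4N : allB DN (fun cn => anyB DP (fun cm => liveB cm.1 cn.1)) = true := by decide +kernel

/-! ## §5 The certificate and its consequences -/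

theorem onAlphabet_D : D.OnAlphabet 9 := by
  intro c hc f
  rcases List.mem_append.1 hc with hN | hP
  · obtain ⟨m, hm⟩ := exists_of_mem_suppN hN
    exact onAlphabet_of_B ((allB_iff _ _).1 alphaN (c, m) hm) f
  · obtain ⟨m, hm⟩ := exists_of_mem_suppP hP
    exact onAlphabet_of_B ((allB_iff _ _).1 alphaP (c, m) hm) f

theorem a1_D : D.A1 := by
  constructor
  · intro w hne h1 h2
    have hr := (allB_iff _ _).1 a1_table w (mem_allWords w)
    unfold a1Row at hr
    cases hb : efreeB w with
    | true => exact (hne (efree_of_efreeB hb)).elim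
    | false =>
      rw [hb] at hr
      simp only [cond_false, Bool.or_eq_true, decide_eq_true_eq] at hr
      rcases hr with hbl | hz
      · rcases bloch_of_blochB hbl with h | h
        · exact (h1 h).elim
        · exact (h2 h).elim
      · rw [T_closed, hz]; ext <;> simp [toG]
  · intro w w' hw hw' hd
    have hr := (allB_iff _ _).1 a1_table w (mem_allWords w)
    have hr' := (allB_iff _ _).1 a1_table w' (mem_allWords w')
    unfold a1Row at hr hr'
    rw [efreeB_of_efree hw] at hr
    rw [efreeB_of_efree hw'] at hr'
    simp only [cond_true, decide_eq_true_eq] at hr hr'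
    have hdd : degB w = degB w' := by rw [← deg_eq_degB, ← deg_eq_degB, hd]
    rw [T_closed, T_closed, hr, hr', hdd]

theorem mu_eq : D.mu = ⟨0, 43008⟩ := by
  show D.T Word.eeee = _
  rw [T_closed, mu_raw]
  rfl

theorem mu_ne : D.mu ≠ 0 := by
  rw [mu_eq]
  decide

theorem hub4_suppN : hub4 ∈ D.suppN := mem_suppN_of hub4_mem (by decide)

theorem floor4_suppP : floor4 ∈ D.suppP := mem_suppP_of floor4_mem (by decide)

theorem a4_D : D.A4 := by
  constructor
  · intro x hx
    obtain ⟨m, hm⟩ := exists_of_mem_suppP hx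
    exact ⟨hub4, hub4_suppN, live_of_B ((allB_iff _ _).1 a4P (x, m) hm)⟩
  · intro y hy
    obtain ⟨m, hm⟩ := exists_of_mem_suppN hy
    have h := (allB_iff _ _).1 a4N (y, m) hm
    obtain ⟨cm, hcm, hl⟩ := (anyB_iff _ _).1 h
    have hpos : 0 < cm.2 := of_decide_eq_true ((allB_iff _ _).1 posP cm hcm)
    exact ⟨cm.1, mem_suppP_of hcm hpos, live_of_B hl⟩

/-! ## §5b (A4♯): every weakly-live arrow of `D` is live (colour-1's sharp incidence condition), with its shift transport -/

/-- raw NOT-DEAD test (raw form of `NotDead`: equal letters, or `a < a′` with `|dβ|² ≤ Δ²`). -/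
def notDeadB (ℓ ℓ' : Letter) : Bool :=
  (decide (ℓ.a = ℓ'.a) && decide (ℓ.x = ℓ'.x) && decide (ℓ.y = ℓ'.y)) ||
  (decide (ℓ.a < ℓ'.a) && decide ((ℓ'.x - ℓ.x) * (ℓ'.x - ℓ.x) + (ℓ'.y - ℓ.y) * (ℓ'.y - ℓ.y) ≤ (ℓ'.a - ℓ.a) * (ℓ'.a - ℓ.a)))

theorem notDeadB_of {ℓ ℓ' : Letter} (h : NotDead ℓ ℓ') : notDeadB ℓ ℓ' = true := by
  rcases h with h | ⟨ha, hb⟩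
  · subst h
    simp [notDeadB]
  · simp only [notDeadB, Bool.or_eq_true, Bool.and_eq_true, decide_eq_true_eq]
    right
    refine ⟨ha, ?_⟩
    simpa only [pow_two] using hb

/-- raw weakly-live test. -/
def weakLiveB (x y : Cell) : Bool :=
  notDeadB (x 0) (y 0) && notDeadB (x 1) (y 1) && notDeadB (x 2) (y 2) && notDeadB (x 3) (y 3)

theorem weakLiveB_of {x y : Cell} (h : WeakLive x y) : weakLiveB x y = true := by
  simp only [weakLiveB, Bool.and_eq_true]
  exact ⟨⟨⟨notDeadB_of (h 0), notDeadB_of (h 1)⟩, notDeadB_of (h 2)⟩, notDeadB_of (h 3)⟩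

/-- (A4♯) table: for every (P-entry, N-entry) pair, weakly-live ⇒ live. -/
theorem sharpTab : allB DP (fun cm => allB DN (fun cn => !(weakLiveB cm.1 cn.1) || liveB cm.1 cn.1)) = true := by
  decide +kernel

theorem a4sharp_D : D.A4sharp := by
  intro x hx y hy hw
  obtain ⟨m, hm⟩ := exists_of_mem_suppP hx
  obtain ⟨n, hn⟩ := exists_of_mem_suppN hy
  have h := (allB_iff _ _).1 ((allB_iff _ _).1 sharpTab (x, m) hm) (y, n) hn
  rw [weakLiveB_of hw] at h
  simp only [Bool.not_true, Bool.false_or] at h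
  exact live_of_B h

theorem conn_D : D.CONN := D.conn_of_a4 a4_D

theorem shiftL_inj (t : ℤ) (ℓ ℓ' : Letter) : shiftL t ℓ = shiftL t ℓ' ↔ ℓ = ℓ' := by
  obtain ⟨a, x, y⟩ := ℓ
  obtain ⟨a', x', y'⟩ := ℓ'
  simp [shiftL]

theorem notDead_shiftL (t : ℤ) (ℓ ℓ' : Letter) : NotDead (shiftL t ℓ) (shiftL t ℓ') ↔ NotDead ℓ ℓ' := by
  simp only [NotDead, shiftL_inj, shiftL_a, shiftL_x, shiftL_y, add_lt_add_iff_right, add_sub_add_right_eq_sub]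

theorem weakLive_shiftCell (t : ℤ) (x y : Cell) : WeakLive (shiftCell t x) (shiftCell t y) ↔ WeakLive x y := by
  simp only [WeakLive, shiftCell, notDead_shiftL]

/-- (A4♯) is transported along the height tower (incidences only depend on differences). -/
theorem a4sharp_shift (E : Design) (t : ℤ) (hs : E.A4sharp) : (shiftD t E).A4sharp := by
  intro x hx y hy hw
  rw [suppP_shift, List.mem_map] at hx
  rw [suppN_shift, List.mem_map] at hy
  obtain ⟨x₀, hx₀, rfl⟩ := hx
  obtain ⟨y₀, hy₀, rfl⟩ := hy
  exact (live_shiftCell t x₀ y₀).2 (hs x₀ hx₀ y₀ hy₀ ((weakLive_shiftCell t x₀ y₀).1 hw))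

/-! ## §6 The certificate and its consequences -/

/-- THE CERTIFICATE: `D` is an (A1)-clean (A4) design with `μ ≠ 0` on the height-9 alphabet, `136` copies, rank `8`. -/
theorem design_cert : D.OnAlphabet 9 ∧ D.A1 ∧ D.A4 ∧ D.mu ≠ 0 ∧ D.copies = 136 ∧ D.rank = 8 :=
  ⟨onAlphabet_D, a1_D, a4_D, mu_ne, copies_eq, rank_eq⟩

/-- `Nonex 9 136 8` is false. -/
theorem not_nonex_nine : ¬ Nonex 9 136 8 := fun hn =>
  hn D onAlphabet_D a1_D a4_D mu_ne (le_of_eq copies_eq) (le_of_eq rank_eq.symm)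

/-- `Nonex h B 8` is false for every height `h ≥ 9` and every budget `B ≥ 136` (shift the design up by `h − 9`). -/
theorem not_nonex (h : ℤ) (hh : 9 ≤ h) (B : ℕ) (hB : 136 ≤ B) : ¬ Nonex h B 8 := by
  intro hn
  have h9 : Nonex (9 + (h - 9)) B 8 := by
    have : (9 : ℤ) + (h - 9) = h := by ring
    rw [this]; exact hn
  have hn9 : Nonex 9 B 8 := nonex_of_nonex_up (h - 9) (by linarith) h9
  exact hn9 D onAlphabet_D a1_D a4_D mu_ne (by rw [copies_eq]; exact hB) (le_of_eq rank_eq.symm)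

/-- THE INSTANCE OF RECORD: `Nonex 14 199 8` is false. -/
theorem not_nonex_fourteen : ¬ Nonex 14 199 8 := not_nonex 14 (by norm_num) 199 (by norm_num)

/-- `FloorFree 9 B 8` is false for every `B ≥ 136`: the P-cell `(0;4,5)⁴` of `D` is a floor cell. -/
theorem not_floorFree_nine (B : ℕ) (hB : 136 ≤ B) : ¬ FloorFree 9 B 8 := by
  intro hf
  have h := hf D onAlphabet_D a1_D a4_D mu_ne (by rw [copies_eq]; exact hB) (le_of_eq rank_eq.symm) floor4
    (List.mem_append.2 (Or.inr floor4_suppP)) 0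
  exact absurd h (by decide)

/-- the «nine floors» conjunction (`HeightTower.nonex_14_iff_floors`) is false: floor 9 fails. -/
theorem not_nine_floors : ¬ (∀ h : ℤ, 6 ≤ h → h ≤ 14 → FloorFree h 199 8) := fun H =>
  not_floorFree_nine 199 (by norm_num) (H 9 (by norm_num) (by norm_num))

/-- 136-copy designs exist at every height `≥ 9`. -/
theorem exists_design (h : ℤ) (hh : 9 ≤ h) :
    ∃ E : Design, E.OnAlphabet h ∧ E.A1 ∧ E.A4 ∧ E.mu ≠ 0 ∧ E.copies = 136 ∧ E.rank = 8 := by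
  refine ⟨shiftD (h - 9) D, ?_, a1_shiftD (h - 9) D a1_D, a4_shift D (h - 9) a4_D, ?_, ?_, ?_⟩
  · have e : (shiftD (h - 9) D).OnAlphabet (9 + (h - 9)) := onAlphabet_shift_up D 9 (h - 9) (by linarith) onAlphabet_D
    have : (9 : ℤ) + (h - 9) = h := by ring
    rw [this] at e
    exact e
  · rw [mu_shiftD]; exact mu_ne
  · rw [copies_shift]; exact copies_eq
  · rw [rank_shift]; exact rank_eq

/-- THE CONJECTURE OF RECORD IS FALSE: `DepthBound 14 199 8 3` (the statement of `DepthBoundA4.stub_depthBound_three`) fails. -/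
theorem not_depthBound_three : ¬ DepthBound 14 199 8 3 := fun hd =>
  not_nonex_fourteen (a4_closed_of_depthBound_three hd)

/-- the shifted design on the height-14 alphabet. -/
theorem onAlphabet_shift14 : (shiftD 5 D).OnAlphabet 14 := by
  have e := onAlphabet_shift_up D 9 5 (by norm_num) onAlphabet_D
  have h14 : (9 : ℤ) + 5 = 14 := by norm_num
  rw [h14] at e
  exact e

theorem floor_shift14_suppP : shiftCell 5 floor4 ∈ (shiftD 5 D).suppP := by
  rw [suppP_shift]
  exact List.mem_map.2 ⟨floor4, floor4_suppP, rfl⟩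

theorem floor_shift14_colevel : (shiftCell 5 floor4 0).colevel = 9 := by decide

/-- directly: no depth bound `c₀ ≤ 8` holds at `(14, 199, 8)` — the shifted design has the P-letter `(5;4,5)` of co-level 9. -/
theorem not_depthBound (c₀ : ℤ) (hc : c₀ ≤ 8) : ¬ DepthBound 14 199 8 c₀ := by
  intro hd
  have h := hd (shiftD 5 D) onAlphabet_shift14 (a1_shiftD 5 D a1_D) (a4_shift D 5 a4_D) (by rw [mu_shiftD]; exact mu_ne)
    (by rw [copies_shift, copies_eq]; norm_num) (by rw [rank_shift]; exact le_of_eq rank_eq.symm) (shiftCell 5 floor4)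
    (List.mem_append.2 (Or.inr floor_shift14_suppP)) 0
  rw [floor_shift14_colevel] at h
  omega

/-- colour-1's six-hypothesis form `DB c₀ = DepthBoundC1 14 199 8 c₀` ((A4♯) ∧ (CONN) instead of (A4)) is false for every `c₀ ≤ 8`. -/
theorem not_DB (c₀ : ℕ) (hc : c₀ ≤ 8) : ¬ DB c₀ := by
  intro hDB
  have h := hDB (shiftD 5 D) onAlphabet_shift14 (a1_shiftD 5 D a1_D) (by rw [mu_shiftD]; exact mu_ne)
    (by rw [rank_shift]; exact le_of_eq rank_eq.symm) (a4sharp_shift D 5 a4sharp_D)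
    ((shiftD 5 D).conn_of_a4 (a4_shift D 5 a4_D)) (by rw [copies_shift, copies_eq]; norm_num) (shiftCell 5 floor4)
    floor_shift14_suppP 0
  rw [floor_shift14_colevel] at h
  omega

theorem not_DB_three : ¬ DB 3 := not_DB 3 (by norm_num)

/-- the sufficient conditions for `Nonex 14 199 8` recorded in `IntegralityGap.lean` are false too. -/
theorem not_kTops : ¬ KTops 95 := fun h => not_nonex_fourteen (nonex_of_kTops h)

theorem not_sparseNonex : ¬ SparseNonex 14 199 199 8 := fun h => not_nonex_fourteen (nonex_of_sparse h)

theorem not_scaledNonex : ¬ ScaledNonex 14 199 8 := fun h => not_nonex_fourteen (nonex_of_scaledNonex h)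

end Summit.HodgeConjecture.HodgeConjecture.Cruxes.BlochSeedDiscOne.RotatedPairB136
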